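import Summits.AtomisticToContinuum.FouriersLaw.Theorems.BondHeatUncertaintyExtensiveSnapshotIrreversibilityEnergyWindowSkeletonRefinement

/-!
# Crux `ExtensiveSnapshotIrreversibility` (stmt-AtomisticToContinuum-9121): the regularisation
defect of the skeleton weights — `defect_sq_le`, `defect_sq_le_linear`, `tendsto_defect`

Cell decomp-a2c, lens «grading / quantitative ladder», generation 78, part S, file 4 of 4 —
critic row 1077 (b): «the limit order is written INTO the statements: a standalone
`defect_sq_le` (the two-step Loewner / contraction inequality
`|κ(Γ_m+κ)⁻¹e|² ≤ κ⟨e,(Γ_m+κ)⁻¹e⟩ ≤ κ⟨e,(Γ_{m'}+κ)⁻¹e⟩` for `m ≥ m'`) and a `tendsto_defect`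
result (`κ → 0` at fixed `m'`, then `m' → ∞` via eventual surjectivity), consumed verbatim by the
S–U / S–V glues; no glue may pick `m₁` before `κ`».  Imports file 3 (Loewner monotonicity
`posSemidef_skelGramPath_sub`, `posDef_skelGramAt_of_range_eq_top`) and through it part R
(`regInv Γ κ = (Γ + κ)⁻¹`, `skelCtrlArr/Dep = regInv Γ κ *ᵥ e`).  Everything is PROVED.

§1 MATRIX ALGEBRA over `ℝ` (any finite index type): inversion reverses the Loewner order on the
positive cone, in quadratic-form form — `0 ≺ A`, `0 ≺ B`, `B − A ⪰ 0` ⟹ `eᵀB⁻¹e ≤ eᵀA⁻¹e`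
(`dotProduct_inv_mulVec_antitone`: complete the square `(x−A⁻¹e)ᵀA(x−A⁻¹e) ≥ 0` at `x = B⁻¹e`
and use `xᵀAx ≤ xᵀBx = xᵀe`); the first defect step `κ²|a|² ≤ κ·eᵀ(Γ+κ)⁻¹e` for `Γ ⪰ 0`,
`a = (Γ+κ)⁻¹e` (`sq_defect_le`: `eᵀa = aᵀΓa + κ|a|²`); `eᵀ(Γ+κ)⁻¹e ≤ eᵀΓ⁻¹e` for `Γ ≻ 0`
(`dotProduct_regInv_mulVec_le_inv`); and the DOMINATOR `κ·eᵀ(Γ+κ)⁻¹e ≤ |e|²` for `Γ ⪰ 0`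
(`mul_dotProduct_regInv_mulVec_le`).
§2 ALONG THE DRIVING PATH, with `Γ_m = skelGramPath … s m z wp` (file 3) and
`a_{m,κ} = regInv Γ_m κ *ᵥ e` — for `e = momCoord N b` this is R's arrival control
`skelCtrlArr … s m κ b z (pairRem m wp) (pairSkel m wp)` DEFINITIONALLY, and for `e` the departure
vector it is `skelCtrlDep` (that vector does not depend on the level along the path:
`skelDepVec_eq_coordV_fderiv_solMap`, `skelDepVec_level_eq`):
★ `defect_sq_le_normSq`: `κ²|a_{m,κ}|² ≤ |e|²` for EVERY `m`, `κ`, path (the dominated-convergence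
dominator, integrated against `‖∇g‖_∞`);
★ `defect_sq_le`: `m' ≤ m`, `κ > 0` ⟹ `κ²|a_{m,κ}|² ≤ κ · eᵀ(Γ_{m'}+κ)⁻¹e` — the right side
does NOT depend on `m ≥ m'`, so a glue chooses `κ` first and lets `m ≥ max(m', m₁(κ))` float;
★ `defect_sq_le_linear`: if `Γ_{m'} ≻ 0` then `≤ κ · eᵀΓ_{m'}⁻¹e` for all `m ≥ m'`;
★ `tendsto_defect`: hence `κ²|a_{m,κ}|² → 0` as `κ → 0⁺`, for EVERY `m ≥ m'`;
★ `defect_sq_le_linear_of_range_eq_top`: the same with the hypothesis «`D E^{s}_{m'}` onto along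
the path», i.e. in the form (I-s2) at time `s` delivers (generation 80; the tree has `s = 1`,
`exists_forall_range_fderiv_skelFlowMap_eq_top`).  The `m' → ∞` half of the critic's limit
order is exactly that existence statement and is NOT proved here.
No new instance / notation / option.
References: R. Bhatia, Positive Definite Matrices (2007), Ch. 1, and R. Horn, C. Johnson, Matrix
Analysis (2nd ed. 2013), Cor. 7.7.4 (a) (`0 ≺ A ⪯ B ⟹ B⁻¹ ⪯ A⁻¹`); D. Nualart, The Malliavin
Calculus and Related Topics (2006), §2.3 (regularised Malliavin matrix). [folklore]
-/

noncomputable section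

namespace Summit.AtomisticToContinuum.FouriersLaw.Theorems.ExtensiveSnapshotIrreversibility.EnergyWindow

open MeasureTheory ProbabilityTheory Filter Topology Set
open scoped ENNReal NNReal Matrix
open Literature.MathematicalPhysics.KineticTheory.HeatConduction
open Literature.Probability.Process

/-! ## 1. Matrix algebra: the Loewner order is reversed by inversion; the first defect step -/

section MatrixDefect

variable {ι : Type} [Fintype ι]

/-- A real symmetric matrix has a symmetric bilinear form.  Private folklore helper of this file (public twin:
`Literature.Geometry.Lorentzian.dotProduct_mulVec_comm_of_isHermitian`, not imported into this kinetic-theory chain; dedup gate p850390). [folklore] -/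
private theorem dotProduct_mulVec_comm_of_isHermitian {A : Matrix ι ι ℝ} (hA : A.IsHermitian)
    (x y : ι → ℝ) : x ⬝ᵥ (A *ᵥ y) = y ⬝ᵥ (A *ᵥ x) := by
  have hT : Aᵀ = A := by
    have h := hA.eq
    rwa [Matrix.conjTranspose_eq_transpose_of_trivial] at h
  rw [Matrix.dotProduct_mulVec, ← Matrix.mulVec_transpose, hT, dotProduct_comm]

/-- `|a|² = a ⬝ᵥ a ≥ 0`.  Private folklore helper (public twin: `Literature.Computability.QuantumComplexity.Matchgate.dotProduct_self_nonneg`,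
not imported here; dedup gate p850390). [folklore] -/
private theorem dotProduct_self_nonneg' (a : ι → ℝ) : 0 ≤ a ⬝ᵥ a :=
  Finset.sum_nonneg fun i _ => mul_self_nonneg (a i)

variable [DecidableEq ι]

/-- **Inversion reverses the Loewner order on the positive cone** (quadratic-form version):
`0 ≺ A`, `0 ≺ B`, `B − A ⪰ 0` ⟹ `eᵀ B⁻¹ e ≤ eᵀ A⁻¹ e`.  Proof: with `x = B⁻¹e`, `y = A⁻¹e`,
`0 ≤ (x−y)ᵀA(x−y) = xᵀAx − 2xᵀe + yᵀe` and `xᵀAx ≤ xᵀBx = xᵀe`.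
[cite: HornJohnson2013, Cor 7.7.4] -/
theorem dotProduct_inv_mulVec_antitone {A B : Matrix ι ι ℝ} (hA : A.PosDef) (hB : B.PosDef)
    (hAB : (B - A).PosSemidef) (e : ι → ℝ) :
    e ⬝ᵥ (B⁻¹ *ᵥ e) ≤ e ⬝ᵥ (A⁻¹ *ᵥ e) := by
  have hAu : IsUnit A.det := (Matrix.isUnit_iff_isUnit_det _).1 hA.isUnit
  have hBu : IsUnit B.det := (Matrix.isUnit_iff_isUnit_det _).1 hB.isUnit
  set x := B⁻¹ *ᵥ e with hx
  set y := A⁻¹ *ᵥ e with hy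
  have hBx : B *ᵥ x = e := by
    rw [hx, Matrix.mulVec_mulVec, Matrix.mul_nonsing_inv _ hBu, Matrix.one_mulVec]
  have hAy : A *ᵥ y = e := by
    rw [hy, Matrix.mulVec_mulVec, Matrix.mul_nonsing_inv _ hAu, Matrix.one_mulVec]
  have h1 : e ⬝ᵥ x = x ⬝ᵥ (B *ᵥ x) := by rw [hBx, dotProduct_comm]
  have hyAx : y ⬝ᵥ (A *ᵥ x) = x ⬝ᵥ e := by
    rw [dotProduct_mulVec_comm_of_isHermitian hA.isHermitian y x, hAy]
  have hexp : (x - y) ⬝ᵥ (A *ᵥ (x - y)) = x ⬝ᵥ (A *ᵥ x) - 2 * (x ⬝ᵥ e) + y ⬝ᵥ e := by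
    rw [Matrix.mulVec_sub, sub_dotProduct, dotProduct_sub, dotProduct_sub, hAy, hyAx]
    ring
  have h0 : 0 ≤ (x - y) ⬝ᵥ (A *ᵥ (x - y)) := by
    simpa only [star_trivial] using hA.posSemidef.dotProduct_mulVec_nonneg (x - y)
  have h3 : x ⬝ᵥ (A *ᵥ x) ≤ x ⬝ᵥ (B *ᵥ x) := by
    have h := hAB.dotProduct_mulVec_nonneg x
    rw [star_trivial, Matrix.sub_mulVec, dotProduct_sub] at h
    linarith
  have hc1 : e ⬝ᵥ x = x ⬝ᵥ e := dotProduct_comm e x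
  have hc2 : e ⬝ᵥ y = y ⬝ᵥ e := dotProduct_comm e y
  linarith

/-- **The first defect step**: for `Γ ⪰ 0`, `κ > 0` and `a = (Γ+κ)⁻¹ e` (R's `regInv Γ κ *ᵥ e`),
`κ² |a|² ≤ κ · eᵀ (Γ+κ)⁻¹ e`, since `eᵀa = aᵀΓa + κ|a|² ≥ κ|a|²`. [folklore] -/
theorem sq_defect_le {Γ : Matrix ι ι ℝ} (hΓ : Γ.PosSemidef) {κ : ℝ} (hκ : 0 < κ) (e : ι → ℝ) :
    κ ^ 2 * ((regInv Γ κ *ᵥ e) ⬝ᵥ (regInv Γ κ *ᵥ e)) ≤ κ * (e ⬝ᵥ (regInv Γ κ *ᵥ e)) := by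
  set a := regInv Γ κ *ᵥ e with ha
  have hPD : (Γ + κ • (1 : Matrix ι ι ℝ)).PosDef :=
    Matrix.PosDef.posSemidef_add hΓ (Matrix.PosDef.one.smul hκ)
  have hu : IsUnit (Γ + κ • (1 : Matrix ι ι ℝ)).det :=
    (Matrix.isUnit_iff_isUnit_det _).1 hPD.isUnit
  have he : (Γ + κ • (1 : Matrix ι ι ℝ)) *ᵥ a = e := by
    rw [ha, regInv, Matrix.mulVec_mulVec, Matrix.mul_nonsing_inv _ hu, Matrix.one_mulVec]
  have hea : e ⬝ᵥ a = a ⬝ᵥ (Γ *ᵥ a) + κ * (a ⬝ᵥ a) := by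
    rw [← he, Matrix.add_mulVec, add_dotProduct, Matrix.smul_mulVec, Matrix.one_mulVec,
      smul_dotProduct, smul_eq_mul, dotProduct_comm (Γ *ᵥ a) a]
  have hpsd : 0 ≤ a ⬝ᵥ (Γ *ᵥ a) := by
    simpa only [star_trivial] using hΓ.dotProduct_mulVec_nonneg a
  rw [hea]
  nlinarith [mul_nonneg hκ.le hpsd]

/-- **Regularisation is dominated by the inverse**: for `Γ ≻ 0`, `κ > 0`,
`eᵀ (Γ+κ)⁻¹ e ≤ eᵀ Γ⁻¹ e`. [folklore] -/
theorem dotProduct_regInv_mulVec_le_inv {Γ : Matrix ι ι ℝ} (hΓ : Γ.PosDef) {κ : ℝ} (hκ : 0 < κ)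
    (e : ι → ℝ) : e ⬝ᵥ (regInv Γ κ *ᵥ e) ≤ e ⬝ᵥ (Γ⁻¹ *ᵥ e) := by
  rw [regInv]
  refine dotProduct_inv_mulVec_antitone hΓ
    (Matrix.PosDef.posSemidef_add hΓ.posSemidef (Matrix.PosDef.one.smul hκ)) ?_ e
  rw [add_sub_cancel_left]
  exact Matrix.PosSemidef.one.smul hκ.le

/-- **The regularised resolvent is bounded by `κ⁻¹`** (quadratic form): `Γ ⪰ 0`, `κ > 0` ⟹
`κ · eᵀ(Γ+κ)⁻¹e ≤ |e|²` (`(Γ+κ)⁻¹ ≤ (κ·1)⁻¹ = κ⁻¹·1` by `dotProduct_inv_mulVec_antitone`).  The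
DOMINATOR of the `κ → 0⁺` dominated-convergence step of parts U/V: uniform in `Γ`, hence in the
level and in the path. [folklore] -/
theorem mul_dotProduct_regInv_mulVec_le {Γ : Matrix ι ι ℝ} (hΓ : Γ.PosSemidef) {κ : ℝ}
    (hκ : 0 < κ) (e : ι → ℝ) : κ * (e ⬝ᵥ (regInv Γ κ *ᵥ e)) ≤ e ⬝ᵥ e := by
  have hA : (κ • (1 : Matrix ι ι ℝ)).PosDef := Matrix.PosDef.one.smul hκ
  have hB : (Γ + κ • (1 : Matrix ι ι ℝ)).PosDef := Matrix.PosDef.posSemidef_add hΓ hA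
  have hinv : (κ • (1 : Matrix ι ι ℝ))⁻¹ = κ⁻¹ • (1 : Matrix ι ι ℝ) :=
    Matrix.inv_eq_left_inv (by
      rw [Matrix.smul_mul, one_mul, smul_smul, inv_mul_cancel₀ hκ.ne', one_smul])
  have h1 : e ⬝ᵥ (regInv Γ κ *ᵥ e) ≤ e ⬝ᵥ ((κ • (1 : Matrix ι ι ℝ))⁻¹ *ᵥ e) := by
    rw [regInv]
    refine dotProduct_inv_mulVec_antitone hA hB ?_ e
    rw [add_sub_cancel_right]
    exact hΓ
  rw [hinv, Matrix.smul_mulVec, Matrix.one_mulVec, dotProduct_smul, smul_eq_mul] at h1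
  calc κ * (e ⬝ᵥ (regInv Γ κ *ᵥ e)) ≤ κ * (κ⁻¹ * (e ⬝ᵥ e)) :=
        mul_le_mul_of_nonneg_left h1 hκ.le
    _ = e ⬝ᵥ e := by rw [← mul_assoc, mul_inv_cancel₀ hκ.ne', one_mul]

end MatrixDefect

/-! ## 2. Along the driving path: `defect_sq_le`, `defect_sq_le_linear`, `tendsto_defect` -/

section Defect

variable {ω₂ lam β γ : ℝ} (hω : 0 < ω₂) (hl : 0 ≤ lam) (hβ : 0 ≤ β) (hγ : 0 ≤ γ) (N : ℕ)
  (T_L T_R : ℝ)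

/-- R's arrival control along the path IS `regInv Γ_m κ *ᵥ momCoord N b` (definitional; recorded
so that the glues may quote `defect_sq_le` with `e = momCoord N b`). [folklore] -/
theorem skelCtrlArr_path_eq (s : ℝ) (m : ℕ) (κ : ℝ) (b : Fin N) (z : PhaseSpace N)
    (wp : WienerPair) :
    skelCtrlArr ω₂ lam β γ N T_L T_R s m κ b z (pairRem m wp) (pairSkel m wp) =
      regInv (skelGramPath ω₂ lam β γ N T_L T_R s m z wp) κ *ᵥ momCoord N b := rfl

/-- R's departure control along the path IS `regInv Γ_m κ *ᵥ (departure vector)`. [folklore] -/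
theorem skelCtrlDep_path_eq (s : ℝ) (m : ℕ) (κ : ℝ) (b : Fin N) (z : PhaseSpace N)
    (wp : WienerPair) :
    skelCtrlDep ω₂ lam β γ N T_L T_R s m κ b z (pairRem m wp) (pairSkel m wp) =
      regInv (skelGramPath ω₂ lam β γ N T_L T_R s m z wp) κ *ᵥ
        skelDepVec ω₂ lam β γ N T_L T_R s m b z (pairRem m wp) (pairSkel m wp) := rfl

/-- ★ **The level-free, path-free dominator**: for EVERY level `m`, `κ > 0`, path `wp` and `e`,
`κ² |a_{m,κ}|² ≤ |e|²` (`sq_defect_le` + `mul_dotProduct_regInv_mulVec_le`) — what the `κ → 0⁺`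
dominated convergence of parts U/V integrates against `‖∇g‖_∞`; no hypothesis on `m`, no `m₁`.
[folklore] -/
theorem defect_sq_le_normSq (s : ℝ) (m : ℕ) (z : PhaseSpace N) (wp : WienerPair) {κ : ℝ}
    (hκ : 0 < κ) (e : Fin N ⊕ Fin N → ℝ) :
    κ ^ 2 * ((regInv (skelGramPath ω₂ lam β γ N T_L T_R s m z wp) κ *ᵥ e) ⬝ᵥ
        (regInv (skelGramPath ω₂ lam β γ N T_L T_R s m z wp) κ *ᵥ e)) ≤ e ⬝ᵥ e :=
  (sq_defect_le (posSemidef_skelGramAt z _ _) hκ e).trans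
    (mul_dotProduct_regInv_mulVec_le (posSemidef_skelGramAt z _ _) hκ e)

include hω hl hβ hγ

/-- **The departure vector is level-independent along the path**: it is the coordinate vector of
`∂_z Φ_s(z, pairPath wp)[(0, e_b)]` (R `pinnedChain_solMap_eq_skelFlowMapAt`, pointwise in `z`).
[folklore] -/
theorem skelDepVec_eq_coordV_fderiv_solMap {s : ℝ} (hs : s ∈ Icc (0 : ℝ) 1) (m : ℕ) (b : Fin N)
    (z : PhaseSpace N) (wp : WienerPair) :
    skelDepVec ω₂ lam β γ N T_L T_R s m b z (pairRem m wp) (pairSkel m wp) =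
      coordV N (fderiv ℝ
        (fun z' => (pinnedChain ω₂ lam β γ).solMap N T_L T_R s z' (pairPath wp)) z
        ((0 : Fin N → ℝ), Pi.single b 1)) := by
  have hfun :
      (fun z' => skelFlowMapAt ω₂ lam β γ N T_L T_R s m z' (pairRem m wp) (pairSkel m wp)) =
      fun z' => (pinnedChain ω₂ lam β γ).solMap N T_L T_R s z' (pairPath wp) :=
    funext fun z' => (pinnedChain_solMap_eq_skelFlowMapAt hω hl hβ hγ N T_L T_R hs m z' wp).symm
  rw [skelDepVec, hfun]

/-- Hence the departure vectors of two levels agree along the path. [folklore] -/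
theorem skelDepVec_level_eq {s : ℝ} (hs : s ∈ Icc (0 : ℝ) 1) (m m' : ℕ) (b : Fin N)
    (z : PhaseSpace N) (wp : WienerPair) :
    skelDepVec ω₂ lam β γ N T_L T_R s m b z (pairRem m wp) (pairSkel m wp) =
      skelDepVec ω₂ lam β γ N T_L T_R s m' b z (pairRem m' wp) (pairSkel m' wp) := by
  rw [skelDepVec_eq_coordV_fderiv_solMap hω hl hβ hγ N T_L T_R hs m,
    skelDepVec_eq_coordV_fderiv_solMap hω hl hβ hγ N T_L T_R hs m']

/-- **`eᵀ(Γ_m+κ)⁻¹e` is non-increasing in the level** along the path (`m' ≤ m`, `κ > 0`):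
file 3's Loewner monotonicity reversed by inversion (§1). [folklore] -/
theorem dotProduct_regInv_skelGramPath_antitone {s : ℝ} (hs : s ∈ Icc (0 : ℝ) 1)
    (z : PhaseSpace N) (wp : WienerPair) {κ : ℝ} (hκ : 0 < κ) (e : Fin N ⊕ Fin N → ℝ)
    {m' m : ℕ} (h : m' ≤ m) :
    e ⬝ᵥ (regInv (skelGramPath ω₂ lam β γ N T_L T_R s m z wp) κ *ᵥ e) ≤
      e ⬝ᵥ (regInv (skelGramPath ω₂ lam β γ N T_L T_R s m' z wp) κ *ᵥ e) := by
  simp only [regInv, skelGramPath_eq]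
  refine dotProduct_inv_mulVec_antitone (posDef_skelGramAt_add_smul hκ z _ _)
    (posDef_skelGramAt_add_smul hκ z _ _) ?_ e
  rw [add_sub_add_right_eq_sub]
  exact posSemidef_skelGramPath_sub hω hl hβ hγ N T_L T_R hs z wp h

/-- ★ **`defect_sq_le` (critic row 1077 (b))**: along the driving path, for `m' ≤ m`, `κ > 0`
and any `e`, with `a_{m,κ} = (Γ_m+κ)⁻¹ e`: `κ² |a_{m,κ}|² ≤ κ · eᵀ(Γ_{m'}+κ)⁻¹e`.  UNIFORM in
`m ≥ m'`: a glue chooses `κ` first and lets `m ≥ max(m', m₁(κ))` float. [folklore] -/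
theorem defect_sq_le {s : ℝ} (hs : s ∈ Icc (0 : ℝ) 1) (z : PhaseSpace N) (wp : WienerPair)
    {κ : ℝ} (hκ : 0 < κ) (e : Fin N ⊕ Fin N → ℝ) {m' m : ℕ} (h : m' ≤ m) :
    κ ^ 2 * ((regInv (skelGramPath ω₂ lam β γ N T_L T_R s m z wp) κ *ᵥ e) ⬝ᵥ
        (regInv (skelGramPath ω₂ lam β γ N T_L T_R s m z wp) κ *ᵥ e)) ≤
      κ * (e ⬝ᵥ (regInv (skelGramPath ω₂ lam β γ N T_L T_R s m' z wp) κ *ᵥ e)) :=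
  (sq_defect_le (posSemidef_skelGramAt z _ _) hκ e).trans
    (mul_le_mul_of_nonneg_left
      (dotProduct_regInv_skelGramPath_antitone hω hl hβ hγ N T_L T_R hs z wp hκ e h) hκ.le)

/-- ★ **`defect_sq_le_linear`**: if `Γ_{m'} ≻ 0` along the path then for every `m ≥ m'` and
`κ > 0`, `κ² |a_{m,κ}|² ≤ κ · eᵀ Γ_{m'}⁻¹ e` — linear in `κ`, uniformly in `m ≥ m'`.
[folklore] -/
theorem defect_sq_le_linear {s : ℝ} (hs : s ∈ Icc (0 : ℝ) 1) (z : PhaseSpace N)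
    (wp : WienerPair) {m' : ℕ} (hPD : (skelGramPath ω₂ lam β γ N T_L T_R s m' z wp).PosDef)
    {κ : ℝ} (hκ : 0 < κ) (e : Fin N ⊕ Fin N → ℝ) {m : ℕ} (h : m' ≤ m) :
    κ ^ 2 * ((regInv (skelGramPath ω₂ lam β γ N T_L T_R s m z wp) κ *ᵥ e) ⬝ᵥ
        (regInv (skelGramPath ω₂ lam β γ N T_L T_R s m z wp) κ *ᵥ e)) ≤
      κ * (e ⬝ᵥ ((skelGramPath ω₂ lam β γ N T_L T_R s m' z wp)⁻¹ *ᵥ e)) :=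
  (defect_sq_le hω hl hβ hγ N T_L T_R hs z wp hκ e h).trans
    (mul_le_mul_of_nonneg_left (dotProduct_regInv_mulVec_le_inv hPD hκ e) hκ.le)

/-- ★ **`tendsto_defect` (critic row 1077 (b), the `κ → 0⁺` half at fixed `m'`)**: if
`Γ_{m'} ≻ 0` along the path then for EVERY `m ≥ m'` the squared defect `κ² |(Γ_m+κ)⁻¹e|²` tends
to `0` as `κ → 0⁺` (squeezed by `κ · eᵀΓ_{m'}⁻¹e`, a bound not depending on `m`).  The `m' → ∞`
half (such an `m'` exists along almost every path) is (I-s2) at time `s`, not proved here.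
[folklore] -/
theorem tendsto_defect {s : ℝ} (hs : s ∈ Icc (0 : ℝ) 1) (z : PhaseSpace N) (wp : WienerPair)
    {m' : ℕ} (hPD : (skelGramPath ω₂ lam β γ N T_L T_R s m' z wp).PosDef)
    (e : Fin N ⊕ Fin N → ℝ) {m : ℕ} (h : m' ≤ m) :
    Tendsto (fun κ : ℝ => κ ^ 2 *
        ((regInv (skelGramPath ω₂ lam β γ N T_L T_R s m z wp) κ *ᵥ e) ⬝ᵥ
          (regInv (skelGramPath ω₂ lam β γ N T_L T_R s m z wp) κ *ᵥ e)))
      (𝓝[>] 0) (𝓝 0) := by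
  have hup : Tendsto
      (fun κ : ℝ => κ * (e ⬝ᵥ ((skelGramPath ω₂ lam β γ N T_L T_R s m' z wp)⁻¹ *ᵥ e)))
      (𝓝[>] 0) (𝓝 0) := by
    have h0 := (tendsto_id (x := 𝓝 (0 : ℝ))).mul_const
      (e ⬝ᵥ ((skelGramPath ω₂ lam β γ N T_L T_R s m' z wp)⁻¹ *ᵥ e))
    rw [zero_mul] at h0
    exact h0.mono_left nhdsWithin_le_nhds
  refine tendsto_of_tendsto_of_tendsto_of_le_of_le' tendsto_const_nhds hup
    (eventually_nhdsWithin_of_forall fun κ _ => ?_)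
    (eventually_nhdsWithin_of_forall fun κ hκ => ?_)
  · exact mul_nonneg (sq_nonneg κ) (dotProduct_self_nonneg' _)
  · exact defect_sq_le_linear hω hl hβ hγ N T_L T_R hs z wp hPD hκ e h

/-- ★ **The defect bound from ONTO at level `m'`** (the form in which (I-s2) at time `s`
delivers the hypothesis): if `D E^{s}_{m'}(Ξ_{m'} wp)` is onto phase space then for all
`m ≥ m'`, `κ > 0`: `κ² |a_{m,κ}|² ≤ κ · eᵀ Γ_{m'}⁻¹ e`. [folklore] -/
theorem defect_sq_le_linear_of_range_eq_top {s : ℝ} (hs : s ∈ Icc (0 : ℝ) 1) (z : PhaseSpace N)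
    (wp : WienerPair) {m' : ℕ}
    (hsurj : LinearMap.range
      (fderiv ℝ (skelFlowMapAt ω₂ lam β γ N T_L T_R s m' z (pairRem m' wp)) (pairSkel m' wp) :
        PairSkeleton m' →ₗ[ℝ] PhaseSpace N) = ⊤)
    {κ : ℝ} (hκ : 0 < κ) (e : Fin N ⊕ Fin N → ℝ) {m : ℕ} (h : m' ≤ m) :
    κ ^ 2 * ((regInv (skelGramPath ω₂ lam β γ N T_L T_R s m z wp) κ *ᵥ e) ⬝ᵥ
        (regInv (skelGramPath ω₂ lam β γ N T_L T_R s m z wp) κ *ᵥ e)) ≤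
      κ * (e ⬝ᵥ ((skelGramPath ω₂ lam β γ N T_L T_R s m' z wp)⁻¹ *ᵥ e)) :=
  defect_sq_le_linear hω hl hβ hγ N T_L T_R hs z wp
    (posDef_skelGramAt_of_range_eq_top z _ _ hsurj) hκ e h

end Defect

end Summit.AtomisticToContinuum.FouriersLaw.Theorems.ExtensiveSnapshotIrreversibility.EnergyWindow
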